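import Summits.Ventures.YMGap.RobustBall.PerturbedAutomorphismCovariance
import Literature.MathematicalPhysics.QuantumLattice.CPeriodicBoundaryConditions
import HarnessLib

/-!
# Venture YMGap, track ROBUST-BALL — ONE STATE, step 19: CHARGE CONJUGATION — the one state of `SU(N)` lattice Yang–Mills is invariant
# under complex conjugation of all link variables

HONEST FRAMING. WHAT THIS IS: a venture file (cell `pub-ymgap`, track Y2 ROBUST-BALL, seat ds-3, theorems only) instantiating
`PerturbedAutomorphismCovariance.lean` with LATTICE CHARGE CONJUGATION: entrywise complex conjugation `U ↦ Ū` of every link variable is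
a continuous involutive automorphism of `SU(N)` preserving the fundamental character `Re tr` (lit's monoid endomorphism
`suConj N`, `conj_mem_specialUnitaryGroup` of `CPeriodicBoundaryConditions.lean`; here `re_trace_map_conj`, `exists_chargeConj_aut`), so ★ under `MassGapAt d N β` (Wilson, every `d`, `N`) and under `PerturbedMassGapAt` for members with
conjugation-invariant Hamiltonians, THE ONE STATE IS CHARGE-CONJUGATION INVARIANT (`oneState_chargeConjInvariant_of_massGapAt`,
`oneState_chargeConjInvariant_of_perturbedMassGapAt`); the `SU(2)` cell at every `|b| ≤ 9/50` (`su2_wilson_oneState_chargeConjInvariant`).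
Together with the hyperoctahedral symmetry (`OneStateReflection.lean`) this gives C and P invariance of the strong-coupling one state. To stay
definition-free the conjugated link is written with lit's `suConj N` (the C-periodic boundary condition's conjugation endomorphism).
WHAT THIS IS NOT: lattice statements only; nothing about the continuum limit or the Clay Millennium problem.

References: E. Seiler, LNP 159 (1982), Ch. 1; the track's `PerturbedAutomorphismCovariance.lean`.
-/

noncomputable section

open MeasureTheory Filter Function
open Literature.Probability.LatticeModels hiding configShift configShift_apply
open Literature.MathematicalPhysics.QuantumLattice
open Literature.MathematicalPhysics.QuantumFieldTheory hiding ZdEdge Site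

namespace Summit.Ventures.YMGap.RobustBall

section Conj

variable {N : ℕ}

/-- Conjugating twice is the identity. [folklore] -/
theorem map_conj_map_conj (A : Matrix (Fin N) (Fin N) ℂ) : (A.map (starRingEnd ℂ)).map (starRingEnd ℂ) = A := by
  ext i j
  simp

/-- `Re tr Ū = Re tr U`. [folklore] -/
theorem re_trace_map_conj (A : Matrix (Fin N) (Fin N) ℂ) : (A.map (starRingEnd ℂ)).trace.re = A.trace.re := by
  rw [← AddMonoidHom.map_trace (starRingEnd ℂ : ℂ →+* ℂ) A, Complex.conj_re]

/-- **Lattice charge conjugation as a continuous involutive automorphism of `SU(N)` preserving the fundamental character** — packaged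
as an existence statement (no new definition): there is `σ : SU(N) ≃* SU(N)`, continuous with continuous inverse, with
`σ U = suConj N U = Ū` and `Re tr σ U = Re tr U`. [folklore] -/
theorem exists_chargeConj_aut :
    ∃ σ : SUN N ≃* SUN N, Continuous σ ∧ Continuous σ.symm ∧ (∀ g : SUN N, σ g = suConj N g) ∧
      ∀ g : SUN N, ((fundamentalRep (Fin N)) (σ g)).trace.re = ((fundamentalRep (Fin N)) g).trace.re := by
  have hcc : ∀ g : SUN N, suConj N (suConj N g) = g := fun g =>
    Subtype.ext (by rw [coe_suConj, coe_suConj]; exact map_conj_map_conj _)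
  have hcont : Continuous fun g : SUN N => suConj N g :=
    ((continuous_subtype_val.matrix_map Complex.continuous_conj).subtype_mk _).congr fun g => rfl
  let σ : SUN N ≃* SUN N :=
    { toFun := suConj N, invFun := suConj N, left_inv := hcc, right_inv := hcc, map_mul' := (suConj N).map_mul }
  exact ⟨σ, hcont, hcont, fun g => rfl, fun g => by
    show (((suConj N g : SUN N) : Matrix (Fin N) (Fin N) ℂ)).trace.re = ((g : SUN N) : Matrix (Fin N) (Fin N) ℂ).trace.re
    rw [coe_suConj]
    exact re_trace_map_conj _⟩

end Conj

section Currencies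

variable {d N : ℕ}

/-- ★★ **WILSON ACTION (every `d`, `N`): under `MassGapAt d N β` THE ONE STATE IS CHARGE-CONJUGATION INVARIANT** — invariant under
`U ↦ Ū = suConj N U` on every link (`oneState_autInvariant_of_massGapAt` with the conjugation automorphism of `exists_chargeConj_aut`). [folklore] -/
theorem oneState_chargeConjInvariant_of_massGapAt {β : ℝ} (hgap : MassGapAt d N β) :
    ∃ μ : Measure (LGConfig d (SUN N)),
      ymGibbsMeasures (d := d) (fundamentalRep (Fin N)) ((N : ℝ) * β) = {μ} ∧
        μ.map (fun U e => suConj N (U e)) = μ := by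
  obtain ⟨σ, hσ, hσ', hσeq, hρσ⟩ := exists_chargeConj_aut (N := N)
  obtain ⟨μ, hG, hμ⟩ := oneState_autInvariant_of_massGapAt hgap σ hσ hσ' hρσ
  refine ⟨μ, hG, ?_⟩
  have e : (fun (U : LGConfig d (SUN N)) (e : ZdEdge d) => suConj N (U e)) = fun U e => σ (U e) := by
    funext U e
    rw [hσeq]
  rw [e]
  exact hμ

/-- ★★ **TIER 1: the one state of a member whose finite-volume Hamiltonians are conjugation invariant is charge-conjugation invariant**
(`PerturbedMassGapAt d N β W supp`, continuous terms reading their own links, locally finite support). [folklore] -/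
theorem oneState_chargeConjInvariant_of_perturbedMassGapAt {β : ℝ} {W : Potential (ZdEdge d) (SUN N)}
    {supp : Finset (ZdEdge d) → Finset (Finset (ZdEdge d))} (hgap : PerturbedMassGapAt d N β W supp)
    (hWc : ∀ X, Continuous (W X)) (hdep : ∀ X, DependsOn (W X) (↑X : Set (ZdEdge d))) (hsupp : W.IsSupportedBy supp)
    (hH : ∀ (Λ : Finset (ZdEdge d)) (U : LGConfig d (SUN N)),
      hamiltonianIn W supp Λ (fun e => suConj N (U e)) = hamiltonianIn W supp Λ U) :
    ∃ μ : Measure (LGConfig d (SUN N)),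
      perturbedGibbsMeasures (d := d) (fundamentalRep (Fin N)) ((N : ℝ) * β) W supp = {μ} ∧
        μ.map (fun U e => suConj N (U e)) = μ := by
  obtain ⟨σ, hσ, hσ', hσeq, hρσ⟩ := exists_chargeConj_aut (N := N)
  have e : (fun (U : LGConfig d (SUN N)) (e : ZdEdge d) => suConj N (U e)) = fun U e => σ (U e) := by
    funext U e
    rw [hσeq]
  have hH' : ∀ (Λ : Finset (ZdEdge d)) (U : LGConfig d (SUN N)),
      hamiltonianIn W supp Λ (fun e => σ (U e)) = hamiltonianIn W supp Λ U := fun Λ U => by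
    have h := hH Λ U
    rw [show (fun e : ZdEdge d => σ (U e)) = fun e => suConj N (U e) from funext fun e => hσeq (U e)]
    exact h
  obtain ⟨μ, hG, hμ⟩ := oneState_autInvariant_of_perturbedMassGapAt hgap hWc hdep hsupp σ hσ hσ' hρσ hH'
  refine ⟨μ, hG, ?_⟩
  rw [e]
  exact hμ

/-- ★ **`SU(2)` Wilson on `ℤ⁴`, TWO-SIDED, every `|b| ≤ 9/50` (Wilson `|β_W| ≤ 9/25`): the one state is charge-conjugation invariant.**
[folklore] -/
theorem su2_wilson_oneState_chargeConjInvariant {b : ℝ} (h : |b| ≤ 9 / 50) :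
    ∃ μ : Measure (LGConfig 4 (SUN 2)),
      ymGibbsMeasures (d := 4) (fundamentalRep (Fin 2)) b = {μ} ∧
        μ.map (fun U e => suConj 2 (U e)) = μ := by
  have hm := ImprovedThresholdStar.su2_massGapAt_of_abs_le (β := b / 2) (by rw [abs_div, abs_two]; linarith)
  have e : (((2 : ℕ) : ℝ)) * (b / 2) = b := by push_cast; ring
  have h := oneState_chargeConjInvariant_of_massGapAt hm
  rwa [e] at h

end Currencies

end Summit.Ventures.YMGap.RobustBall

end
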